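import Summits.Ventures.HodgeRepro2.T5BorelHyperbolic
import Summits.Ventures.HodgeRepro2.T5BorelWittOne

/-!
# T5IsotropicTransitivity — U(ℍ) and U(ℍ ⊕ ⟨a⟩) act transitively on isotropic lines, so every
line stabiliser is conjugate to the Borel (cell pub-hodge-repro2, seat p3)

Files 25/26 described the stabiliser `B` of the isotropic line `⟨e₁⟩` of `ℍ` resp. `ℍ ⊕ ⟨a⟩` and
proved `[B, B] = N`. MVW's parabolic `P′₁` / `P₁` (T5-SUPPORT-p3 §14(d), Q-7) is the stabiliser of
the isotropic line of the FIXED flag — an arbitrary isotropic line. This file supplies the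
transitivity (Witt's theorem, here by explicit matrices):

* `U(ℍ)`: `isotropic v ↔ v̄₀ v₁ + v̄₁ v₀ = 0`; `exists_mulVec_eq_smul`: every non-zero isotropic `v`
  is `c • (g e₁)` for some `g ∈ U(ℍ)`, `c ≠ 0` (`g` = a lower unipotent `!![1, 0; u, 1]`, `ū = -u`,
  or the Weyl element `w = !![0, 1; 1, 0]`); `mem_lineStabilizer_iff_conj`: the stabiliser of
  `⟨v⟩` is `g B g⁻¹` elementwise.
* `U(J_a)`: the same with `g = w n(y, z) w` (the Heisenberg element conjugated by the Weyl element
  `w = !![0, 0, 1; 0, 1, 0; 1, 0, 0]`) or `g = w` (`exists_mulVec_eq_smul_J`,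
  `mem_lineStabilizerJ_iff_conj`).

Consequently `N_L := [Stab(L), Stab(L)] = g N g⁻¹` for every isotropic line `L = g ⟨e₁⟩`, and a
character of the group is trivial on `N_L` — the cuspidality clause of §14(e) for MVW's own
parabolic, whichever isotropic line the fixed flag starts with. Standard axioms.
-/

namespace Summit.Ventures.HodgeRepro2.T5IsotropicTransitivity

open Matrix
open T5UnipotentCommutator T5HeisenbergCommutator

variable {E : Type*} [Field E] [StarRing E]

/-! ## The hyperbolic plane -/

/-- The hermitian form of `ℍ`: `h(v, w) = v̄₀ w₁ + v̄₁ w₀`. -/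
def hypForm (v w : Fin 2 → E) : E := star (v 0) * w 1 + star (v 1) * w 0

/-- `hypForm v w = vᴴ ℍ w` (as `star v ⬝ᵥ ℍ.mulVec w`). -/
theorem hypForm_eq (v w : Fin 2 → E) :
    hypForm v w = (star ∘ v) ⬝ᵥ ((hyp : Matrix (Fin 2) (Fin 2) E).mulVec w) := by
  simp [hypForm, hyp_eq, dotProduct, Matrix.mulVec, Fin.sum_univ_two]

/-- The four entry relations of `gᴴ ℍ g = ℍ` for `g ∈ U(ℍ)`. -/
theorem unitary_entries (g : hypUnitary E) :
    star (mat (g : GL (Fin 2) E) 0 0) * mat (g : GL (Fin 2) E) 1 0 +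
        star (mat (g : GL (Fin 2) E) 1 0) * mat (g : GL (Fin 2) E) 0 0 = 0 ∧
      star (mat (g : GL (Fin 2) E) 0 0) * mat (g : GL (Fin 2) E) 1 1 +
        star (mat (g : GL (Fin 2) E) 1 0) * mat (g : GL (Fin 2) E) 0 1 = 1 ∧
      star (mat (g : GL (Fin 2) E) 0 1) * mat (g : GL (Fin 2) E) 1 0 +
        star (mat (g : GL (Fin 2) E) 1 1) * mat (g : GL (Fin 2) E) 0 0 = 1 ∧
      star (mat (g : GL (Fin 2) E) 0 1) * mat (g : GL (Fin 2) E) 1 1 +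
        star (mat (g : GL (Fin 2) E) 1 1) * mat (g : GL (Fin 2) E) 0 1 = 0 := by
  have hg := (mem_hypUnitary_iff (g : GL (Fin 2) E)).mp g.2
  rw [Matrix.eta_fin_two (mat (g : GL (Fin 2) E)), hyp_eq, conjTranspose_fin_two,
    Matrix.mul_fin_two, Matrix.mul_fin_two] at hg
  refine ⟨?_, ?_, ?_, ?_⟩
  · have := congrFun (congrFun hg 0) 0
    simp at this
    linear_combination this
  · have := congrFun (congrFun hg 0) 1
    simp at this
    linear_combination this
  · have := congrFun (congrFun hg 1) 0
    simp at this
    linear_combination this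
  · have := congrFun (congrFun hg 1) 1
    simp at this
    linear_combination this

/-- The form is preserved by `U(ℍ)`: `h(g v, g w) = h(v, w)`. -/
theorem hypForm_mulVec (g : hypUnitary E) (v w : Fin 2 → E) :
    hypForm ((mat (g : GL (Fin 2) E)).mulVec v) ((mat (g : GL (Fin 2) E)).mulVec w) =
      hypForm v w := by
  obtain ⟨e00, e01, e10, e11⟩ := unitary_entries g
  simp only [hypForm, Matrix.mulVec, dotProduct, Fin.sum_univ_two, star_add, star_mul]
  linear_combination (star (v 0) * w 0) * e00 + (star (v 0) * w 1) * e01 +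
    (star (v 1) * w 0) * e10 + (star (v 1) * w 1) * e11

/-- The lower unipotent matrix `!![1, 0; u, 1]`, as a unit. -/
def lowerUnit (u : E) : GL (Fin 2) E where
  val := !![1, 0; u, 1]
  inv := !![1, 0; -u, 1]
  val_inv := by simp [Matrix.one_fin_two]
  inv_val := by simp [Matrix.one_fin_two]

omit [StarRing E] in
/-- The underlying matrix of `lowerUnit u`. -/
@[simp]
theorem lowerUnit_val (u : E) : mat (lowerUnit u) = !![1, 0; u, 1] := rfl

/-- `!![1, 0; u, 1] ∈ U(ℍ)` for `ū = -u`. -/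
theorem lowerUnit_mem_hypUnitary (u : E) (hu : star u = -u) : lowerUnit u ∈ hypUnitary E := by
  rw [mem_hypUnitary_iff, lowerUnit_val, hyp_eq, conjTranspose_fin_two, Matrix.mul_fin_two,
    Matrix.mul_fin_two]
  simp [hu]

/-- The Weyl element `w = !![0, 1; 1, 0]`, as a unit (its own inverse). -/
def weylUnit : GL (Fin 2) E where
  val := !![0, 1; 1, 0]
  inv := !![0, 1; 1, 0]
  val_inv := by simp [Matrix.one_fin_two]
  inv_val := by simp [Matrix.one_fin_two]

omit [StarRing E] in
/-- The underlying matrix of the Weyl element. -/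
@[simp]
theorem weylUnit_val : mat (weylUnit : GL (Fin 2) E) = !![0, 1; 1, 0] := rfl

/-- `w ∈ U(ℍ)`. -/
theorem weylUnit_mem_hypUnitary : (weylUnit : GL (Fin 2) E) ∈ hypUnitary E := by
  rw [mem_hypUnitary_iff, weylUnit_val, hyp_eq, conjTranspose_fin_two, Matrix.mul_fin_two,
    Matrix.mul_fin_two]
  simp

/-- TRANSITIVITY: every non-zero isotropic vector of `ℍ` is a non-zero multiple of `g e₁` for some
`g ∈ U(ℍ)`. -/
theorem exists_mulVec_eq_smul (v : Fin 2 → E) (hv : v ≠ 0) (hiso : hypForm v v = 0) :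
    ∃ g ∈ hypUnitary E, ∃ c : E, c ≠ 0 ∧ (mat g).mulVec ![1, 0] = c • v := by
  by_cases hx : v 0 = 0
  · -- `v = (0, v₁)`: the line `⟨e₂⟩ = w ⟨e₁⟩`
    have hy : v 1 ≠ 0 := by
      intro hy
      apply hv
      ext i
      fin_cases i <;> simp [hx, hy]
    refine ⟨weylUnit, weylUnit_mem_hypUnitary, (v 1)⁻¹, inv_ne_zero hy, ?_⟩
    ext i
    fin_cases i <;> simp [weylUnit_val, Matrix.mulVec, dotProduct, Fin.sum_univ_two, hx,
      inv_mul_cancel₀ hy]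
  · -- `v = v₀ (1, u)` with `u = v₀⁻¹ v₁`, `ū = -u` by isotropy
    set u := (v 0)⁻¹ * v 1 with hu_def
    have hsx : star (v 0) ≠ 0 := star_ne_zero.mpr hx
    have hu : star u = -u := by
      rw [hu_def, star_mul, star_inv₀]
      have h := hiso
      unfold hypForm at h
      field_simp
      linear_combination h
    refine ⟨lowerUnit u, lowerUnit_mem_hypUnitary u hu, (v 0)⁻¹, inv_ne_zero hx, ?_⟩
    ext i
    fin_cases i <;> simp [lowerUnit_val, Matrix.mulVec, dotProduct, Fin.sum_univ_two, hu_def,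
      inv_mul_cancel₀ hx]

/-- `g⁻¹ (g x) = x` for `g ∈ U(ℍ)`. -/
theorem inv_mulVec_mulVec (g : hypUnitary E) (x : Fin 2 → E) :
    (T5UnipotentCommutator.mat ((g⁻¹ : hypUnitary E) : GL (Fin 2) E)).mulVec
      ((T5UnipotentCommutator.mat (g : GL (Fin 2) E)).mulVec x) = x := by
  rw [Matrix.mulVec_mulVec, Subgroup.coe_inv, T5UnipotentCommutator.mat_inv_mul, Matrix.one_mulVec]

/-- `g (g⁻¹ x) = x` for `g ∈ U(ℍ)`. -/
theorem mulVec_inv_mulVec (g : hypUnitary E) (x : Fin 2 → E) :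
    (T5UnipotentCommutator.mat (g : GL (Fin 2) E)).mulVec
      ((T5UnipotentCommutator.mat ((g⁻¹ : hypUnitary E) : GL (Fin 2) E)).mulVec x) = x := by
  rw [Matrix.mulVec_mulVec, Subgroup.coe_inv, T5UnipotentCommutator.mat_mul_inv, Matrix.one_mulVec]

/-- `(g⁻¹ h g) x = g⁻¹ (h (g x))`. -/
theorem conj_mulVec (g h : hypUnitary E) (x : Fin 2 → E) :
    (T5UnipotentCommutator.mat ((g⁻¹ * h * g : hypUnitary E) : GL (Fin 2) E)).mulVec x =
      (T5UnipotentCommutator.mat ((g⁻¹ : hypUnitary E) : GL (Fin 2) E)).mulVec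
        ((T5UnipotentCommutator.mat (h : GL (Fin 2) E)).mulVec
          ((T5UnipotentCommutator.mat (g : GL (Fin 2) E)).mulVec x)) := by
  rw [Subgroup.coe_mul, Subgroup.coe_mul, T5UnipotentCommutator.mat_mul,
    T5UnipotentCommutator.mat_mul, ← Matrix.mulVec_mulVec, ← Matrix.mulVec_mulVec]

/-- The stabiliser of the line `⟨v⟩` is the conjugate `g B g⁻¹` of the Borel, elementwise:
for `g e₁ = c • v` (`c ≠ 0`), `h ∈ U(ℍ)` maps `⟨v⟩` to itself iff `g⁻¹ h g ∈ B`. -/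
theorem mem_lineStabilizer_iff_conj (g h : hypUnitary E) (v : Fin 2 → E) (c : E) (hc : c ≠ 0)
    (hg : (T5UnipotentCommutator.mat (g : GL (Fin 2) E)).mulVec ![1, 0] = c • v) :
    (∃ c' : E, (T5UnipotentCommutator.mat (h : GL (Fin 2) E)).mulVec v = c' • v) ↔
      g⁻¹ * h * g ∈ T5BorelHyperbolic.borel E := by
  rw [T5BorelHyperbolic.mem_borel_iff_stabilizes]
  have he1 : (![1, 0] : Fin 2 → E) =
      c • (T5UnipotentCommutator.mat ((g⁻¹ : hypUnitary E) : GL (Fin 2) E)).mulVec v := by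
    rw [← Matrix.mulVec_smul, ← hg, inv_mulVec_mulVec]
  constructor
  · rintro ⟨c', hc'⟩
    refine ⟨c', ?_⟩
    rw [conj_mulVec, hg, Matrix.mulVec_smul, hc', Matrix.mulVec_smul, Matrix.mulVec_smul, he1,
      smul_comm]
  · rintro ⟨c', hc'⟩
    refine ⟨c', ?_⟩
    rw [conj_mulVec] at hc'
    have h2 : (T5UnipotentCommutator.mat (h : GL (Fin 2) E)).mulVec
        ((T5UnipotentCommutator.mat (g : GL (Fin 2) E)).mulVec ![1, 0]) =
        c' • (T5UnipotentCommutator.mat (g : GL (Fin 2) E)).mulVec ![1, 0] := by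
      have := congrArg (fun x => (T5UnipotentCommutator.mat (g : GL (Fin 2) E)).mulVec x) hc'
      simpa only [mulVec_inv_mulVec, Matrix.mulVec_smul] using this
    rw [hg, Matrix.mulVec_smul, smul_comm] at h2
    exact smul_right_injective _ hc h2

/-! ## The space `ℍ ⊕ ⟨a⟩` -/

/-- The hermitian form of `J_a`: `h(v, w) = v̄₀ w₂ + a v̄₁ w₁ + v̄₂ w₀`. -/
def formJa (a : E) (v w : Fin 3 → E) : E :=
  star (v 0) * w 2 + a * (star (v 1) * w 1) + star (v 2) * w 0

/-- The Weyl element `w = !![0, 0, 1; 0, 1, 0; 1, 0, 0]` of `U(J_a)`, as a unit (its own inverse). -/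
def weylUnitJ : GL (Fin 3) E where
  val := !![0, 0, 1; 0, 1, 0; 1, 0, 0]
  inv := !![0, 0, 1; 0, 1, 0; 1, 0, 0]
  val_inv := by simp [Matrix.one_fin_three]
  inv_val := by simp [Matrix.one_fin_three]

omit [StarRing E] in
/-- The underlying matrix of `weylUnitJ`. -/
@[simp]
theorem weylUnitJ_val : mat (weylUnitJ : GL (Fin 3) E) = !![0, 0, 1; 0, 1, 0; 1, 0, 0] := rfl

/-- `w ∈ U(J_a)`. -/
theorem weylUnitJ_mem_unitaryJ (a : E) : (weylUnitJ : GL (Fin 3) E) ∈ unitaryJ a := by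
  rw [mem_unitaryJ_iff, weylUnitJ_val, formJ, conjTranspose_fin_three, Matrix.mul_fin_three,
    Matrix.mul_fin_three]
  simp

/-- TRANSITIVITY for `J_a` (`ā = a ≠ 0`): every non-zero isotropic vector is a non-zero multiple
of `g e₁` for some `g ∈ U(J_a)`. -/
theorem exists_mulVec_eq_smul_J (a : E) (ha : star a = a) (ha0 : a ≠ 0) (v : Fin 3 → E)
    (hv : v ≠ 0) (hiso : formJa a v v = 0) :
    ∃ g ∈ unitaryJ a, ∃ c : E, c ≠ 0 ∧ (T5HeisenbergCommutator.mat g).mulVec ![1, 0, 0] = c • v := by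
  by_cases hx : v 0 = 0
  · -- `v₀ = 0` forces `v₁ = 0` (`a ≠ 0`), so `v = v₂ e₃ = v₂ w e₁`
    have hy : v 1 = 0 := by
      unfold formJa at hiso
      rw [hx, star_zero, zero_mul, zero_add, mul_zero, add_zero] at hiso
      rcases mul_eq_zero.mp hiso with h | h
      · exact absurd h ha0
      · rcases mul_eq_zero.mp h with h' | h'
        · exact star_eq_zero.mp h'
        · exact h'
    have hz : v 2 ≠ 0 := by
      intro hz
      apply hv
      ext i
      fin_cases i <;> simp [hx, hy, hz]
    refine ⟨weylUnitJ, weylUnitJ_mem_unitaryJ a, (v 2)⁻¹, inv_ne_zero hz, ?_⟩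
    ext i
    fin_cases i <;> simp [weylUnitJ_val, Matrix.mulVec, dotProduct, Fin.sum_univ_three, hx, hy,
      inv_mul_cancel₀ hz]
  · -- `v = v₀ (1, y, z)` with `z + z̄ + a ȳ y = 0`: `(1, y, z) = (w n(y, z) w) e₁`
    set y := (v 0)⁻¹ * v 1 with hy_def
    set z := (v 0)⁻¹ * v 2 with hz_def
    have hsx : star (v 0) ≠ 0 := star_ne_zero.mpr hx
    have htr : z + star z + a * star y * y = 0 := by
      rw [hy_def, hz_def]
      simp only [star_mul, star_inv₀]
      have h := hiso
      unfold formJa at h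
      field_simp
      linear_combination h
    have hn : heisUnit a y z ∈ unitaryJ a := (heisUnit_mem_unitaryJ_iff a ha y z).mpr htr
    have hw : (weylUnitJ : GL (Fin 3) E) ∈ unitaryJ a := weylUnitJ_mem_unitaryJ a
    refine ⟨weylUnitJ * heisUnit a y z * weylUnitJ,
      (unitaryJ a).mul_mem ((unitaryJ a).mul_mem hw hn) hw, (v 0)⁻¹, inv_ne_zero hx, ?_⟩
    rw [T5HeisenbergCommutator.mat_mul, T5HeisenbergCommutator.mat_mul, weylUnitJ_val, heisUnit_val, heis]
    ext i
    fin_cases i <;> simp [Matrix.mulVec, dotProduct, Fin.sum_univ_three, hy_def, hz_def,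
      inv_mul_cancel₀ hx]

/-- `g⁻¹ (g x) = x` for `g ∈ U(J_a)`. -/
theorem inv_mulVec_mulVec_J {a : E} (g : unitaryJ a) (x : Fin 3 → E) :
    (T5HeisenbergCommutator.mat ((g⁻¹ : unitaryJ a) : GL (Fin 3) E)).mulVec
      ((T5HeisenbergCommutator.mat (g : GL (Fin 3) E)).mulVec x) = x := by
  rw [Matrix.mulVec_mulVec, Subgroup.coe_inv, ← T5HeisenbergCommutator.mat_mul, inv_mul_cancel]
  simp [T5HeisenbergCommutator.mat]

/-- `g (g⁻¹ x) = x` for `g ∈ U(J_a)`. -/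
theorem mulVec_inv_mulVec_J {a : E} (g : unitaryJ a) (x : Fin 3 → E) :
    (T5HeisenbergCommutator.mat (g : GL (Fin 3) E)).mulVec
      ((T5HeisenbergCommutator.mat ((g⁻¹ : unitaryJ a) : GL (Fin 3) E)).mulVec x) = x := by
  rw [Matrix.mulVec_mulVec, Subgroup.coe_inv, T5HeisenbergCommutator.mat_mul_inv, Matrix.one_mulVec]

/-- `(g⁻¹ h g) x = g⁻¹ (h (g x))`. -/
theorem conj_mulVec_J {a : E} (g h : unitaryJ a) (x : Fin 3 → E) :
    (T5HeisenbergCommutator.mat ((g⁻¹ * h * g : unitaryJ a) : GL (Fin 3) E)).mulVec x =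
      (T5HeisenbergCommutator.mat ((g⁻¹ : unitaryJ a) : GL (Fin 3) E)).mulVec
        ((T5HeisenbergCommutator.mat (h : GL (Fin 3) E)).mulVec
          ((T5HeisenbergCommutator.mat (g : GL (Fin 3) E)).mulVec x)) := by
  rw [Subgroup.coe_mul, Subgroup.coe_mul, T5HeisenbergCommutator.mat_mul,
    T5HeisenbergCommutator.mat_mul, ← Matrix.mulVec_mulVec, ← Matrix.mulVec_mulVec]

/-- The stabiliser of the isotropic line `⟨v⟩` in `U(J_a)` is the conjugate `g B g⁻¹` of the
Borel, elementwise: for `g e₁ = c • v` (`c ≠ 0`), `h` maps `⟨v⟩` to itself iff `g⁻¹ h g ∈ B`. -/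
theorem mem_lineStabilizerJ_iff_conj {a : E} (ha0 : a ≠ 0) (g h : unitaryJ a) (v : Fin 3 → E)
    (c : E) (hc : c ≠ 0)
    (hg : (T5HeisenbergCommutator.mat (g : GL (Fin 3) E)).mulVec ![1, 0, 0] = c • v) :
    (∃ c' : E, (T5HeisenbergCommutator.mat (h : GL (Fin 3) E)).mulVec v = c' • v) ↔
      g⁻¹ * h * g ∈ T5BorelWittOne.borelJ a ha0 := by
  rw [T5BorelWittOne.mem_borelJ_iff_stabilizes]
  have he1 : (![1, 0, 0] : Fin 3 → E) =
      c • (T5HeisenbergCommutator.mat ((g⁻¹ : unitaryJ a) : GL (Fin 3) E)).mulVec v := by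
    rw [← Matrix.mulVec_smul, ← hg, inv_mulVec_mulVec_J]
  constructor
  · rintro ⟨c', hc'⟩
    refine ⟨c', ?_⟩
    rw [conj_mulVec_J, hg, Matrix.mulVec_smul, hc', Matrix.mulVec_smul, Matrix.mulVec_smul, he1,
      smul_comm]
  · rintro ⟨c', hc'⟩
    refine ⟨c', ?_⟩
    rw [conj_mulVec_J] at hc'
    have h2 : (T5HeisenbergCommutator.mat (h : GL (Fin 3) E)).mulVec
        ((T5HeisenbergCommutator.mat (g : GL (Fin 3) E)).mulVec ![1, 0, 0]) =
        c' • (T5HeisenbergCommutator.mat (g : GL (Fin 3) E)).mulVec ![1, 0, 0] := by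
      have := congrArg (fun x => (T5HeisenbergCommutator.mat (g : GL (Fin 3) E)).mulVec x) hc'
      simpa only [mulVec_inv_mulVec_J, Matrix.mulVec_smul] using this
    rw [hg, Matrix.mulVec_smul, smul_comm] at h2
    exact smul_right_injective _ hc h2

end Summit.Ventures.HodgeRepro2.T5IsotropicTransitivity
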